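import Summits.AtomisticToContinuum.Crystallization.Theorems.ChartedZeroExcessLayeredLatticeLiouvilleZZZYRCZX

/-!
# (U♯) by scale strata: the WINDOWED target, the union glue, the windowed doors, the coarse re-charting leaf — lens-2 g100 «ZZZYRE»

Finding «COARSE-CHART» (lens-2 g100, NODE 11): at the route instance `Λ = 2` the family of equilibrium charts `IsEquilChart a s Λ L w` is not
single-scale — every fine chart (`2‖L‖ ≤ Λ`) has an index-4 twin `(2L, w₂)` with the SAME point set (file ZZZYREB: `isEquilChart_double`), on
which every co-Lipschitz presentation has constant `≤ ‖L‖/3` and NO registered presentation exists (`IsRegisteredWord` orders coplanar layers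
by height).  So `(U♯) s Λ κ₀ c₀ = UniformEquilStabilityAt` must be earned stratum by stratum with stratum-dependent constants, and the
registered re-indexing `UniformReindexPC … (IsRegisteredWord δ)` of the doors of record (ZZZYRCZN / ZZZYRCZX) only on the fine stratum.

This file types exactly that, with no new mathematics: §1 the windowed target `UniformEquilStabilityAtIn s Λ κ₀ c₀ W` (`W : Set ℝ` a scale
window; `W = univ` is (U♯)), its monotonicity, and the UNION GLUE `uniformEquilStabilityAt_of_union` (two strata with their own constants and
a scale cover ⇒ (U♯) with the minimum constants); §2 the windowed re-indexing `UniformReindexPCIn` with class transfer, and the WINDOWED DOORS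
`uniformEquilStabilityAtIn_of_atlasC` / `uniformEquilStabilityAtIn_of_atlasW_hollow` (the proofs of ZZZYRCZN / ZZZYRCZX verbatim, one binder
`a ∈ W` more; every other leaf is over admissible words and unchanged); §3 the coarse strata as ONE named leaf `CoarseRechartP` and the
assembly `uniformEquilStabilityAt_of_fine_coarse`.

§1 2 defs + 6 theorems · §2 1 def + 7 theorems + 2 consistency examples · §3 1 def + 1 theorem.  Tags: [g100] new here.
-/

noncomputable section

namespace Summit.AtomisticToContinuum.Crystallization.Theorems.ChartedZeroExcessLayeredLatticeLiouville

open scoped BigOperators RealInnerProductSpace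
open Summit.AtomisticToContinuum.Crystallization.Theorems.ChartedPlanarOrderRigidityDoor (E3)
open Summit.AtomisticToContinuum.Crystallization.Theorems.ChartedPlanarOrderMesoCut (LayeredHom)
open Summit.AtomisticToContinuum.Crystallization.Theorems.ChartedPlanarOrderDoorLayered (Layered)
open Literature.MathematicalPhysics.StatisticalMechanics (triangularVec₁ triangularVec₂)

variable {ι : Type*}

/-! ### §1 the windowed target and the union glue -/

/-- ★ **(U♯-W) «UniformEquilStabilityAtIn s Λ κ₀ c₀ W»** — (U♯) `UniformEquilStabilityAt s Λ κ₀ c₀` restricted to the scales `a ∈ W`: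
ONE pair of constants serves every equilibrium chart whose scale lies in the window `W`.  `W = univ` is (U♯) (`uniformEquilStabilityAtIn_univ`); the
intended instance is the FINE stratum `W = Icc amin amax` of `ScaleBandP`.  Why it might fail: as (U♯), per stratum. [g100] -/
def UniformEquilStabilityAtIn (s Λ κ₀ c₀ : ℝ) (W : Set ℝ) : Prop :=
  ∀ a : ℝ, a ∈ W → 0 < a →
    ∀ (L : E3 ≃L[ℝ] E3) (w : ℤ → E3), IsEquilChart a s Λ L w →
      ∃ w' : ℤ → E3,
        Layered ((L : E3 →L[ℝ] E3) (triangularVec₁ 1)) ((L : E3 →L[ℝ] E3) (triangularVec₂ 1)) w' = LayeredHom (L : E3 →L[ℝ] E3) w ∧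
        IsLayeredCrystal c₀ ((L : E3 →L[ℝ] E3) (triangularVec₁ 1)) ((L : E3 →L[ℝ] E3) (triangularVec₂ 1)) w' ∧
        CoerciveZ (layeredKernel ((L : E3 →L[ℝ] E3) (triangularVec₁ 1)) ((L : E3 →L[ℝ] E3) (triangularVec₂ 1)) w') κ₀

/-- the full window is (U♯). [g100] -/
theorem uniformEquilStabilityAtIn_univ {s Λ κ₀ c₀ : ℝ} :
    UniformEquilStabilityAtIn s Λ κ₀ c₀ Set.univ ↔ UniformEquilStabilityAt s Λ κ₀ c₀ :=
  ⟨fun h a ha L w hE => h a (Set.mem_univ a) ha L w hE, fun h a _ ha L w hE => h a ha L w hE⟩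

/-- (U♯) restricts to every window. [g100] -/
theorem UniformEquilStabilityAt.restrict {s Λ κ₀ c₀ : ℝ} (h : UniformEquilStabilityAt s Λ κ₀ c₀) (W : Set ℝ) :
    UniformEquilStabilityAtIn s Λ κ₀ c₀ W := fun a _ ha L w hE => h a ha L w hE

/-- a smaller window is a weaker claim. [g100] -/
theorem UniformEquilStabilityAtIn.mono {s Λ κ₀ c₀ : ℝ} {W W' : Set ℝ} (hW : W' ⊆ W) (h : UniformEquilStabilityAtIn s Λ κ₀ c₀ W) :
    UniformEquilStabilityAtIn s Λ κ₀ c₀ W' := fun a haW ha L w hE => h a (hW haW) ha L w hE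

/-- smaller constants are a weaker claim. [g100] -/
theorem UniformEquilStabilityAtIn.of_le {s Λ κ₀ c₀ κ₀' c₀' : ℝ} {W : Set ℝ} (hκ : κ₀' ≤ κ₀) (hc : c₀' ≤ c₀)
    (h : UniformEquilStabilityAtIn s Λ κ₀ c₀ W) : UniformEquilStabilityAtIn s Λ κ₀' c₀' W := by
  intro a haW ha L w hE
  obtain ⟨w', hset, hco, hcoer⟩ := h a haW ha L w hE
  exact ⟨w', hset, hco.of_le hc, hcoer.of_le hκ⟩

/-- **«ChartScaleCoverP s Λ W₁ W₂»** — the scale of every equilibrium chart lies in `W₁ ∪ W₂` (trivial for `W₁ ∪ W₂ = univ`; the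
intended case, fine stratum ∪ coarse strata with a GAP between them, is a CELL-ID statement from `IsClean`). [g100] -/
def ChartScaleCoverP (s Λ : ℝ) (W₁ W₂ : Set ℝ) : Prop :=
  ∀ a : ℝ, 0 < a → ∀ (L : E3 ≃L[ℝ] E3) (w : ℤ → E3), IsEquilChart a s Λ L w → a ∈ W₁ ∨ a ∈ W₂

/-- the trivial cover by a threshold. [g100] -/
theorem chartScaleCoverP_iic_ioi (s Λ amax : ℝ) : ChartScaleCoverP s Λ (Set.Iic amax) (Set.Ioi amax) := fun a _ _ _ _ =>
  le_or_gt a amax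

/-- ★★ **THE UNION GLUE (PROVED)**: (U♯-W₁) with constants `(κ₁, c₁)` ∧ (U♯-W₂) with `(κ₂, c₂)` ∧ the scale cover ⇒ (U♯) with the
constants `(min κ₁ κ₂, min c₁ c₂)`. [g100] -/
theorem uniformEquilStabilityAt_of_union {s Λ κ₁ c₁ κ₂ c₂ : ℝ} {W₁ W₂ : Set ℝ} (h₁ : UniformEquilStabilityAtIn s Λ κ₁ c₁ W₁)
    (h₂ : UniformEquilStabilityAtIn s Λ κ₂ c₂ W₂) (hcov : ChartScaleCoverP s Λ W₁ W₂) :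
    UniformEquilStabilityAt s Λ (min κ₁ κ₂) (min c₁ c₂) := by
  intro a ha L w hE
  rcases hcov a ha L w hE with haW | haW
  · obtain ⟨w', hset, hco, hcoer⟩ := h₁ a haW ha L w hE
    exact ⟨w', hset, hco.of_le (min_le_left _ _), hcoer.of_le (min_le_left _ _)⟩
  · obtain ⟨w', hset, hco, hcoer⟩ := h₂ a haW ha L w hE
    exact ⟨w', hset, hco.of_le (min_le_right _ _), hcoer.of_le (min_le_right _ _)⟩

/-! ### §2 windowed re-indexing and the windowed doors -/

/-- **(RI♯-C-W) «UniformReindexPCIn s Λ c₀ ℓ₀ Can W»** — ZZZYRCZN's re-indexing into the class `Can`, asked only at scales `a ∈ W`.  For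
`Can := IsRegisteredWord δ` and `W` the fine stratum this is the INTENDED (RI♯) (registry lemma: clean ⇒ hollow stacking ⇒ letters); on the coarse
strata the registered class is empty (ZZZYREB), which is why the window is needed. [g100] -/
def UniformReindexPCIn (s Λ c₀ ℓ₀ : ℝ) (Can : ℝ → (E3 ≃L[ℝ] E3) → (ℤ → E3) → Prop) (W : Set ℝ) : Prop :=
  ∀ a : ℝ, a ∈ W → 0 < a → ∀ (L : E3 ≃L[ℝ] E3) (w : ℤ → E3), IsEquilChart a s Λ L w →
    ∃ w' : ℤ → E3, Layered (gen₁ L) (gen₂ L) w' = LayeredHom (L : E3 →L[ℝ] E3) w ∧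
      IsLayeredCrystal c₀ (gen₁ L) (gen₂ L) w' ∧ (∀ m : ℤ, ‖w' (m + 1) - w' m‖ ≤ ℓ₀) ∧ Can a L w'

/-- the unwindowed re-indexing restricts to every window. [g100] -/
theorem UniformReindexPC.restrict {s Λ c₀ ℓ₀ : ℝ} {Can : ℝ → (E3 ≃L[ℝ] E3) → (ℤ → E3) → Prop}
    (h : UniformReindexPC s Λ c₀ ℓ₀ Can) (W : Set ℝ) : UniformReindexPCIn s Λ c₀ ℓ₀ Can W := fun a _ ha L w hE => h a ha L w hE

/-- a smaller window is a weaker claim. [g100] -/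
theorem UniformReindexPCIn.mono {s Λ c₀ ℓ₀ : ℝ} {Can : ℝ → (E3 ≃L[ℝ] E3) → (ℤ → E3) → Prop} {W W' : Set ℝ} (hW : W' ⊆ W)
    (h : UniformReindexPCIn s Λ c₀ ℓ₀ Can W) : UniformReindexPCIn s Λ c₀ ℓ₀ Can W' := fun a haW ha L w hE => h a (hW haW) ha L w hE

/-- CLASS TRANSFER: a pointwise implication between classes on admissible words transfers the windowed re-indexing. [g100] -/
theorem UniformReindexPCIn.imp {s Λ c₀ ℓ₀ : ℝ} {Can Can' : ℝ → (E3 ≃L[ℝ] E3) → (ℤ → E3) → Prop} {W : Set ℝ}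
    (himp : ∀ a : ℝ, 0 < a → ∀ (L : E3 ≃L[ℝ] E3) (w' : ℤ → E3), IsAdmissibleWord a s Λ c₀ ℓ₀ L w' → Can a L w' → Can' a L w')
    (h : UniformReindexPCIn s Λ c₀ ℓ₀ Can W) : UniformReindexPCIn s Λ c₀ ℓ₀ Can' W := by
  intro a haW ha L w hE
  obtain ⟨w', hset, hco, hlip, hcan⟩ := h a haW ha L w hE
  exact ⟨w', hset, hco, hlip, himp a ha L w' (isAdmissibleWord_of_equilChart hE hset hco hlip) hcan⟩

/-- POINTWISE form of ZZZYRCZX's two factorisations: on an admissible word, H-band ∧ hollow stacking turn a registered labelling into a banded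
hollow one (the height of a registered step is its normal component; a repeated letter would make the in-plane part of the step the slip). [g100] -/
theorem isRegisteredWordBH_of_registered {s Λ c₀ ℓ₀ δ hLoB hHiB a : ℝ} {L : E3 ≃L[ℝ] E3} {w' : ℤ → E3} (ha : 0 < a)
    (hB : HBandP s Λ c₀ ℓ₀ hLoB hHiB) (hH : HollowP s Λ c₀ ℓ₀ δ) (hadm : IsAdmissibleWord a s Λ c₀ ℓ₀ L w')
    (hreg : IsRegisteredWord δ a L w') : IsRegisteredWordBH δ hLoB hHiB a L w' := by
  obtain ⟨ℓ, n, r, h, hℓ, hn, hg₁, hg₂, hr, hstep⟩ := hreg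
  have hband := hB a ha L w' hadm n hn hg₁ hg₂
  have hhol := hH a ha L w' hadm n hn hg₁ hg₂
  have hm : ∀ m : ℤ, ⟪w' (m + 1) - w' m, n⟫ = h m := fun m => by
    rw [hstep m]
    exact inner_registeredStep hn hg₁ hg₂ (hr m).2.1 _ _
  refine ⟨ℓ, n, r, h, hℓ, fun m hrep => ?_, hn, hg₁, hg₂, fun m => ⟨(hr m).1, (hr m).2.1, ?_⟩, hstep⟩
  · have hin : (w' (m + 1) - w' m) - ⟪w' (m + 1) - w' m, n⟫ • n = r m := by
      rw [hm m, hstep m, hrep, sub_self, zero_div, zero_smul, zero_add, add_sub_cancel_right]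
    have h1 := hhol m
    rw [hin] at h1
    exact absurd (hr m).1 (not_le.2 h1)
  · have hb := hband m
    rw [hm m, abs_of_pos (hr m).2.2] at hb
    exact hb

/-- the windowed second factorisation: registered re-indexing on `W` ∧ H-band ∧ hollow stacking ⇒ re-indexing into the banded hollow class on `W`.
[g100] -/
theorem uniformReindexPCIn_bandedHollow {s Λ c₀ ℓ₀ δ hLoB hHiB : ℝ} {W : Set ℝ} (hRI : UniformReindexPCIn s Λ c₀ ℓ₀ (IsRegisteredWord δ) W)
    (hB : HBandP s Λ c₀ ℓ₀ hLoB hHiB) (hHol : HollowP s Λ c₀ ℓ₀ δ) : UniformReindexPCIn s Λ c₀ ℓ₀ (IsRegisteredWordBH δ hLoB hHiB) W :=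
  hRI.imp fun _ ha _ _ hadm hreg => isRegisteredWordBH_of_registered ha hB hHol hadm hreg

/-- CONSISTENCY with ZZZYRCZX: the unwindowed factorisation of record is the full-window case. [g100] -/
example {s Λ c₀ ℓ₀ δ hLoB hHiB : ℝ} (hRI : UniformReindexPC s Λ c₀ ℓ₀ (IsRegisteredWord δ)) (hB : HBandP s Λ c₀ ℓ₀ hLoB hHiB)
    (hHol : HollowP s Λ c₀ ℓ₀ δ) : UniformReindexPCIn s Λ c₀ ℓ₀ (IsRegisteredWordBH δ hLoB hHiB) Set.univ :=
  uniformReindexPCIn_bandedHollow (hRI.restrict _) hB hHol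

/-- ★★ **THE WINDOWED ATLAS DOOR FOR A CLASS (PROVED)** — ZZZYRCZN's `uniformEquilStabilityAt_of_atlasC` with the re-indexing asked, and (U♯)
concluded, only at scales `a ∈ W`; every other hypothesis is over admissible words and unchanged.  Proof: verbatim. [g100] -/
theorem uniformEquilStabilityAtIn_of_atlasC {s Λ c₀ ℓ₀ r₁ ϱ R cZ κ₁ κ₀ γT : ℝ} {W : Set ℝ}
    {Can : ℝ → (E3 ≃L[ℝ] E3) → (ℤ → E3) → Prop} {InBox : ι → (E3 ≃L[ℝ] E3) → (ℤ → E3) → Prop} {c cK : ι → ℝ}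
    {ΘR ΘN : ι → (E3 ≃L[ℝ] E3) → (ℤ → E3) → (Cell 2 × ℤ) × (Cell 2 × ℤ) → ℝ}
    (h0 : 0 ≤ κ₁) (hκ : κ₀ ≤ κ₁ * cZ - γT) (hRI : UniformReindexPCIn s Λ c₀ ℓ₀ Can W)
    (hcK0 : ∀ i, 0 ≤ cK i) (hcK : ∀ i, cK i * c i ≤ 1)
    (hCS : CellSumP s Λ c₀ ℓ₀ r₁) (hNC : CellNullLagrangianP s Λ c₀ ℓ₀ r₁) (hcov : AtlasCoversPC s Λ c₀ ℓ₀ Can InBox)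
    (hcell : ∀ i, BoxCellCertificateP s Λ c₀ ℓ₀ r₁ (InBox i) (c i)) (htail : ∀ i, BoxTailDebitP s Λ c₀ ℓ₀ ϱ (InBox i) (ΘR i) (ΘN i) γT)
    (hPU : PartitionIdentityFullP s Λ c₀ ℓ₀ r₁ ϱ R) (hPD : PartitionIdentityDebitP s Λ c₀ ℓ₀ ϱ R)
    (hclus : ∀ i, BoxClusterCertificateDebitP s Λ c₀ ℓ₀ r₁ ϱ R (InBox i) (cK i) (ΘR i) (ΘN i) κ₁)
    (hCZ : IndexCurrencyP s Λ c₀ ℓ₀ r₁ cZ) : UniformEquilStabilityAtIn s Λ κ₀ c₀ W := by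
  intro a haW ha L w hLw
  obtain ⟨w', hset, hco, hlip, hcan⟩ := hRI a haW ha L w hLw
  have hadm : IsAdmissibleWord a s Λ c₀ ℓ₀ L w' := isAdmissibleWord_of_equilChart hLw hset hco hlip
  obtain ⟨i, hBi⟩ := hcov a ha L w' hadm hcan
  refine ⟨w', hset, hco, ?_⟩
  intro φ hφ E hE
  obtain ⟨hK1, -⟩ := contactKorn_at ha hadm (hcK0 i) (hcK i) hCS hNC (hcell i a ha L w' hadm hBi) φ hφ
  have hmain := halfBudget_at ha hadm hPU hPD (hclus i a ha L w' hadm hBi) φ hφ (htail i a ha L w' hadm hBi φ hφ E hE) hK1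
  have hZ0 : 0 ≤ nnFormZ φ := finsum_nonneg fun x => by
    split_ifs <;> positivity
  exact coerciveZ_arith hmain (hCZ a ha L w' hadm φ hφ) hZ0 h0 hκ

/-- CONSISTENCY with ZZZYRCZN: the unwindowed class door is the full-window case of the windowed one. [g100] -/
example {s Λ c₀ ℓ₀ r₁ ϱ R cZ κ₁ κ₀ γT : ℝ} {Can : ℝ → (E3 ≃L[ℝ] E3) → (ℤ → E3) → Prop}
    {InBox : ι → (E3 ≃L[ℝ] E3) → (ℤ → E3) → Prop} {c cK : ι → ℝ}
    {ΘR ΘN : ι → (E3 ≃L[ℝ] E3) → (ℤ → E3) → (Cell 2 × ℤ) × (Cell 2 × ℤ) → ℝ}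
    (h0 : 0 ≤ κ₁) (hκ : κ₀ ≤ κ₁ * cZ - γT) (hRI : UniformReindexPC s Λ c₀ ℓ₀ Can)
    (hcK0 : ∀ i, 0 ≤ cK i) (hcK : ∀ i, cK i * c i ≤ 1)
    (hCS : CellSumP s Λ c₀ ℓ₀ r₁) (hNC : CellNullLagrangianP s Λ c₀ ℓ₀ r₁) (hcov : AtlasCoversPC s Λ c₀ ℓ₀ Can InBox)
    (hcell : ∀ i, BoxCellCertificateP s Λ c₀ ℓ₀ r₁ (InBox i) (c i)) (htail : ∀ i, BoxTailDebitP s Λ c₀ ℓ₀ ϱ (InBox i) (ΘR i) (ΘN i) γT)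
    (hPU : PartitionIdentityFullP s Λ c₀ ℓ₀ r₁ ϱ R) (hPD : PartitionIdentityDebitP s Λ c₀ ℓ₀ ϱ R)
    (hclus : ∀ i, BoxClusterCertificateDebitP s Λ c₀ ℓ₀ r₁ ϱ R (InBox i) (cK i) (ΘR i) (ΘN i) κ₁)
    (hCZ : IndexCurrencyP s Λ c₀ ℓ₀ r₁ cZ) : UniformEquilStabilityAt s Λ κ₀ c₀ :=
  uniformEquilStabilityAtIn_univ.1 (uniformEquilStabilityAtIn_of_atlasC h0 hκ (hRI.restrict _) hcK0 hcK hCS hNC hcov hcell htail hPU hPD hclus hCZ)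

/-- ★★ **THE WINDOWED R3-W DOOR FOR LETTER-FUNCTION BOXES** — ZZZYRCZX's `uniformEquilStabilityAt_of_atlasW_hollow` with the registered
re-indexing asked only on the window `W` (the fine stratum) and (U♯-W) concluded; the door of record for line (D) after «COARSE-CHART». [g100] -/
theorem uniformEquilStabilityAtIn_of_atlasW_hollow {s Λ c₀ ℓ₀ r₁ ϱ R cZ κ₁ κ₀ γT δ hLoB hHiB amin amax : ℝ} {W : Set ℝ}
    {aLo aHi τ hLo hHi c cK : ι → ℝ} {ΘR ΘN : ι → (E3 ≃L[ℝ] E3) → (ℤ → E3) → (Cell 2 × ℤ) × (Cell 2 × ℤ) → ℝ}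
    (h0 : 0 ≤ κ₁) (hκ : κ₀ ≤ κ₁ * cZ - γT) (hRI : UniformReindexPCIn s Λ c₀ ℓ₀ (IsRegisteredWord δ) W)
    (hHB : HBandP s Λ c₀ ℓ₀ hLoB hHiB) (hHol : HollowP s Λ c₀ ℓ₀ δ) (hcK0 : ∀ i, 0 ≤ cK i) (hcK : ∀ i, cK i * c i ≤ 1)
    (hCS : CellSumP s Λ c₀ ℓ₀ r₁) (hNC : CellNullLagrangianP s Λ c₀ ℓ₀ r₁) (hband : ScaleBandP s Λ c₀ ℓ₀ amin amax)
    (hcover : ∀ a : ℝ, amin ≤ a → a ≤ amax → ∃ i, aLo i ≤ a ∧ a ≤ aHi i ∧ δ ≤ τ i ∧ hLo i ≤ hLoB ∧ hHiB ≤ hHi i)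
    (hcell : ∀ i, BoxCellCertificateP s Λ c₀ ℓ₀ r₁ (InBoxWH s (aLo i) (aHi i) (τ i) (hLo i) (hHi i)) (c i))
    (htail : ∀ i, BoxTailDebitP s Λ c₀ ℓ₀ ϱ (InBoxWH s (aLo i) (aHi i) (τ i) (hLo i) (hHi i)) (ΘR i) (ΘN i) γT)
    (hPU : PartitionIdentityFullP s Λ c₀ ℓ₀ r₁ ϱ R) (hPD : PartitionIdentityDebitP s Λ c₀ ℓ₀ ϱ R)
    (hclus : ∀ i, BoxClusterCertificateDebitP s Λ c₀ ℓ₀ r₁ ϱ R (InBoxWH s (aLo i) (aHi i) (τ i) (hLo i) (hHi i)) (cK i) (ΘR i) (ΘN i) κ₁)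
    (hCZ : IndexCurrencyP s Λ c₀ ℓ₀ r₁ cZ) : UniformEquilStabilityAtIn s Λ κ₀ c₀ W :=
  uniformEquilStabilityAtIn_of_atlasC h0 hκ (uniformReindexPCIn_bandedHollow hRI hHB hHol) hcK0 hcK hCS hNC
    (atlasCoversPC_of_shapeCoverWH hband hcover) hcell htail hPU hPD hclus hCZ

/-! ### §3 the coarse strata: one named leaf and the assembly -/

/-- ★ **(RECHART) «CoarseRechartP s Λ κ₀ c₀ κ' c' Wf Wc»** — THE COARSE-STRATUM LEAF: windowed stability on the fine stratum `Wf` with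
constants `(κ₀, c₀)` gives windowed stability on the coarse strata `Wc` with constants `(κ', c')`.  Mechanism (structural, L; no numerics): a
coarse chart is a twin of a fine equilibrium chart with the same point set (`(L/2, w)`, resp. `(L∘R₃₀/√3, w)` — an equilibrium chart IN `Wf`
by CELL-ID «PLANE-COMPLETE»: the close-packed plane through a coarse layer lies in the set); the fine presentation `w_f'` re-indexes the coarse
one, `w'(4p + ε₁ + 2ε₂) := w_f' p + L_f(ε₁t₁ + ε₂t₂)`, along the explicit index bijection
`((I,J), 4p+ε₁+2ε₂) ↦ ((2I+ε₁, 2J+ε₂), p)` of sup-dilation `≤ 3`, so `c' = c₀/3` and `κ' = κ₀/C` (the Hessian `HasSum` is re-indexed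
along the bijection; `nnFormZ` of the pull-back is at most `C ×` `nnFormZ`, a range-3 form against the nearest-neighbour form).  Why it
might fail: only through the cell-identification input (a coarse chart whose plane is not complete). [g100] -/
def CoarseRechartP (s Λ κ₀ c₀ κ' c' : ℝ) (Wf Wc : Set ℝ) : Prop :=
  UniformEquilStabilityAtIn s Λ κ₀ c₀ Wf → UniformEquilStabilityAtIn s Λ κ' c' Wc

/-- ★★ **THE ASSEMBLY OF (U♯) FROM THE STRATA (PROVED)**: fine-stratum stability (the windowed door) ∧ (RECHART) ∧ the scale cover ⇒ (U♯)
with the minimum constants. [g100] -/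
theorem uniformEquilStabilityAt_of_fine_coarse {s Λ κ₀ c₀ κ' c' : ℝ} {Wf Wc : Set ℝ} (hfine : UniformEquilStabilityAtIn s Λ κ₀ c₀ Wf)
    (hre : CoarseRechartP s Λ κ₀ c₀ κ' c' Wf Wc) (hcov : ChartScaleCoverP s Λ Wf Wc) :
    UniformEquilStabilityAt s Λ (min κ₀ κ') (min c₀ c') :=
  uniformEquilStabilityAt_of_union hfine (hre hfine) hcov

end Summit.AtomisticToContinuum.Crystallization.Theorems.ChartedZeroExcessLayeredLatticeLiouville

end
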